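import Summits.QuantumFields.YangMills.Theorems.BalabanUVNodesN07SplitClauseHeadKnitMeetNormalisedTowerW152E
import Summits.QuantumFields.YangMills.Theorems.BalabanUVNodesN07ChartMeetNorm77OfLettersSym152E
import Summits.QuantumFields.YangMills.Theorems.BalabanUVNodesN07Thm4RecordStructureSym152PhiEG
import Summits.QuantumFields.YangMills.Theorems.BalabanUVNodesN07Prop8StepTokenOfRecordOfLettersDbar
import Summits.QuantumFields.YangMills.Theorems.BalabanUVNodesK0HalvingStepOfCoreGuardedChain
import HarnessLib

/-!
# N07 [B11] (= [15] = [Balaban1985Variational]) Sect. F, S6 HEAD — **MODULE 122 = EDITION 90E-G (Sym152EG)**: ✓p746344's E-edition `…Prop8StepTokenOfRecordOfLettersSym152E` (90E, the landed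
# original this file is a TWIN of — №314 (g-1): token substitution only; statement shape identical; no new displayed hypothesis) VERBATIM except that the ONE conditional premise is
# the GUARD EDITION (c-ii)‴ `hT : HThm4RecSym152PhiEG F N Mc ρ (F.L * Mh) κ a₀ Ψ` (MODULE 121; candidate (β′), plan g94 WORD (B) 2026-08-30, transition armed) and the door is
# `hS3NORMSym152PhiE_of_hThm4RecSym152PhiEG … hAdm₁ hAdm₂ …` (the grid implication `hAdm₂`, displayed here since 90″, now FEEDS the premise's datum row).  Everything below is 90E's header.

Cell `pub-ymgap`, seat `pub-ymgap-dag-n07-e` g32 (FAN-OUT §N07 row s3; LANE OWNER of the K0 road chart side).  `--kind proof --supports stmt-QuantumFields-20541 --as helper` (K0⁷);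
count-neutral; def-free; ONE theorem; 90E ∕ 90⁗ ∕ 90″ stay in the tree as the (β) ∕ φ ∕ dbar-currency siblings.  [15] = [Balaban1985Variational]; [6] = [Balaban1985RegularSpaces];
[3] = [Balaban1985Averaging]; [I] = [Balaban1987RG1].

WHAT IS PROVED (sorry-free; no definition; axioms standard).  ★★★ `prop8RegSepTopStepG_of_hThm4RecSym152EG_of_letters (F N)` — `Prop8RegSepTopStepG F N suppDom Adm B₃ a₀ a₁` for EVERY guard
`Adm` implying the V20-G conjuncts and the run's grid numerics, from 90″'s structural ∕ token ∕ budget letters, the ONE CONDITIONAL PREMISE `hT : HThm4RecSym152PhiEG F N Mc ρ (F.L * Mh) κ a₀ Ψ`, the seam HSEAM,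
(c′) `hQnear` (90″'s text at `NrmSymPhiOfRecord … (Ψ ε j)`) and (d′)-Lam `hA1L` (117′'s body).  Proof: 77c⁗E at `Nrm := NrmSymPhiOfRecord … (Ψ ε j)`, HS3NORM-152 := `hS3NORMSym152PhiE_of_hThm4RecSym152PhiEG` (fed `hAdm₂`), HCHART-152 := 89E,
thresholds := MODULE 83 §1.
HONEST SCOPE: by-name composition; `HThm4RecSym152PhiEG` CONDITIONAL (N05's (B′) road + the cross-term bound (B′-5)′, director №311a (β)); HSEAM, (c′), (d′)-Lam, the budget row displayed, NOT discharged here; NO stub registered or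
closed; K0⁷ ∕ K1⁹ NOT closed; N07 NOT discharged; counts unmoved (typed 28∕28 · discharged 8∕27 per the chair); one finite 𝕋⁴ programme at fixed ε — the route closes the conditional
finite-𝕋⁴ rung `BalabanLadder.UV` ONLY; the YM mass gap (Clay) is NOT proved by any of this; nothing continuum ∕ ℝ⁴ ∕ OS.  No `sorry` ∕ `def` ∕ `instance` ∕ `notation`.

References: [15] (144) p. 300, (147)–(153) p. 301, (154)–(159) pp. 302–303, (160)–(168) pp. 303–304, Prop. 8 p. 304; [6] Thm. 2 p. 83, Thm. 4 p. 88, Prop. 6 (1.130)–(1.138) pp. 98–99,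
(1.29) p. 81, (1.131) p. 99; [4] (2.1)–(2.4) p. 224, (2.35) p. 228; [I] (0.1) p. 251, (0.4) p. 253.
-/

set_option autoImplicit false

noncomputable section
open scoped BigOperators Matrix.Norms.L2Operator

namespace Summit.QuantumFields.YangMills.BalabanUVNodes.N07Prop8StepTokenOfRecordOfLettersSym152EG

open Literature.MathematicalPhysics.QuantumFieldTheory.Balaban1983to89
open Literature.MathematicalPhysics.QuantumFieldTheory.Balaban1983to89.Node00
open Literature.MathematicalPhysics.QuantumFieldTheory.Balaban1983to89.B15DeterminingSets
open Literature.MathematicalPhysics.QuantumFieldTheory.Balaban1983to89.B12RegularSpaces111 (gaugeU expI grad)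
open LatticeFieldCalculus (bondAvgIter)
open B15Eq112TorusCover (cover)
open B14DomainGeom (Pt Within)
open B5Eq117TorusCarriers (Mk)
open B5Eq118OneStroke (iterBlockOf)
open B5Prop12FieldsLattice (distSite)
open B8Eq131Cubes (sqLo sqHi box cube)
open B11Eq115Space (levOf)
open B6SectADomainsV1 (Domains)
open B6SectAOperatorsV1 (BondIdx RE dsE QpE)
open Literature.MathematicalPhysics.QuantumFieldTheory.BalabanImbrieJaffe1984to88.BIJ85AxialPropagator411 (BondSpace)
open T4Continuum (T4Family)
open T4AxialGaugeSmallField (castSite)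
open GaugeField (gaugeAct)
open Summit.QuantumFields.YangMills.Theorems.K0FlatCubeOpsTextP (flatH)
open Summit.QuantumFields.YangMills.BalabanUVNodes.N07HalvingStepTopOfLocalLetters (Letters10On)
open Summit.QuantumFields.YangMills.BalabanUVNodes.N07Thm4RecordStructureSym152Phi (NrmSymPhiOfRecord)
open Summit.QuantumFields.YangMills.BalabanUVNodes.N07Thm4RecordStructureSym152PhiEG (HThm4RecSym152PhiEG hS3NORMSym152PhiE_of_hThm4RecSym152PhiEG)
open Summit.QuantumFields.YangMills.BalabanUVNodes.N07ChartMeetNorm77OfLettersSym152E (chartMeetNorm77_of_letters_sym152E)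
open Summit.QuantumFields.YangMills.BalabanUVNodes.N07Prop8StepTokenOfRecordOfLetters (exists_thresholds_of_budget_lt)
open Summit.QuantumFields.YangMills.Theorems.K0HalvingStepOfCoreGuardedChain (prop8RegSepTopStepG_of_datumGaugeSplitCoreG)
open Summit.QuantumFields.YangMills.BalabanUVNodes.N07SplitClauseHeadKnitMeetNormalisedTowerW152E (datumGaugeSplitTopStepCoreG_of_normalisedGauge_of_chartMeetTowerW152E)

/-! ## §1  The budget's two thresholds: MODULE 83's `exists_thresholds_of_budget_lt`, imported by name -/

/-! ## §2  The guarded [15] Prop. 8 step token of record from `HThm4Rec`, (c′), (d′) and the closed-form budget row -/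

open scoped Classical in
/-- ★★★ **THE GUARDED [15] PROP. 8 STEP TOKEN OF RECORD, END TO END — GUARD EDITION (twin of ✓p746344-E `prop8RegSepTopStepG_of_hThm4RecSym152E_of_letters`: `hT`'s type is (c-ii)‴ at modulus
`L·Mh` and the door is MODULE 121's, fed the displayed `hAdm₂`; every other byte identical)** — MODULE 77c's `prop8RegSepTopStepG_of_normalisedGauge_of_chartMeetTowerW` at the normalisation text of record
`Nrm := NrmSymPhiOfRecord F N Mc ρ ψ`, with its HS3NORM-152 hypothesis DISCHARGED by the conditional door `hS3NORMSym152Phi_of_hThm4RecSym152Phi` from the ONE named premise `hT : HThm4RecSym152Phi F N Mc ρ κ a₀ ψ`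
([6] Thm. 4 ∕ Prop. 6 with [15] (152)–(153) and «ū = 1 on Λ′» for the record structure — CONDITIONAL, N05-REC's target), its HCHART-MEET-NORM-77 hypothesis DISCHARGED by MODULE 82b's
`chartMeetNorm77_of_letters` from the two displayed chart letters (c′) `hQnear` (near rows of the block averages `QA`, print (156)∕(160)) and (d′) `hA1` (the (158) letters of
`A − H_V(𝟙_reach·QA)`), and its HLETTERS∕HBUDGET-NORM hypotheses read at the letters of record `β₂ := κ·L·ε_j`, `s′ := 0`, `θ_H := 8C_H B_H e^{−δ_H ρ}` as the sign `0 ≤ β₁` and ONE closed-form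
strict budget row in `β₁`, `t₁`.  Every other binder is 77c's, byte for byte; `κ` is now POSITIVE (the door's guard).  Conclusion: `Prop8RegSepTopStepG F N suppDom Adm B₃ a₀ a₁` for EVERY guard
`Adm` implying the V20-G conjuncts and the run's grid numerics.  Nothing registered or closed; `HThm4Rec`, (c′), (d′), the budget row displayed, discharged by nobody.
[cite: Balaban1985Variational, Prop. 8 p.304, (144) p.300, (147)–(153) p.301, (154)–(159) pp.302–303, (160)–(168) pp.303–304; Balaban1985RegularSpaces, Thm. 4 p.88, Prop. 6 (1.130)–(1.138) p.99, (1.29) p.81, (1.131) p.99; Balaban1984PropagatorsII, (2.1)–(2.4) p.224, (2.35) p.228; Balaban1987RG1, (0.1) p.251, (0.4) p.253] -/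
theorem prop8RegSepTopStepG_of_hThm4RecSym152EG_of_letters (F : T4Family) (N : ℕ) [NeZero N] :
    ∃ (Mh₀ R₀ : ℕ) (CH δH BH : ℝ), 0 ≤ CH ∧ 0 < δH ∧ 0 < BH ∧
    ∀ {ρ : ℕ}
      -- structural letters (77c): grid cube `Mc`, block height `a′` (`M_h = L^{a′} ≥ M_h⁰`), `R ≥ R₀`, the collar `ρ` with `L·M_h ∣ ρ`, `R·L·M_h ≤ ρ`, `L ≤ ρ`
      {Mc Mh R a' : ℕ} (_ : 1 ≤ Mc) (_ : Mc ≤ ρ) (_ : Mh = F.L ^ a') (_ : Mh₀ ≤ Mh) (_ : R₀ ≤ R) (_ : F.L * Mh ∣ ρ) (_ : R * (F.L * Mh) ≤ ρ) (hLρ : F.L ≤ ρ)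
      -- the two constants of the plan's V20-G guard `c ≤ ν.M₁ ∧ k + c₀ ≤ F.m + K` and their side conditions (77c ∕ FILE D)
      {c c₀ : ℕ} (_ : (11 * 4 + 4 * ρ + Mc + 3) * F.L ≤ c) (_ : Mc + 11 * 4 + 6 * ρ ≤ 2 * F.L ^ c₀) (_ : F.m ≤ c₀) (_ : a' + 3 ≤ c₀)
      -- ★ THE GUARD: any step guard implying the V20-G conjuncts AND the run's grid numerics the meet's (2.1) needs (`hgran`, `hdiv`)
      (Adm : StepGuard F) (_ : ∀ (ν : Stage7Numerics) (M : ℕ) (g : ℕ → ℝ) (K k : ℕ) (s : SeqOfRecord F ν M g K k), Adm ν M g K k s → c ≤ ν.M₁ ∧ k + c₀ ≤ F.m + K)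
      (_ : ∀ (ν : Stage7Numerics) (M : ℕ) (g : ℕ → ℝ) (K k : ℕ) (s : SeqOfRecord F ν M g K k), Adm ν M g K k s → ∀ j : ℕ, 1 ≤ j → j ≤ k →
        F.L * Mh ∣ M * RkOfRecord (F.P K).L ν.r (g j) ∧ dCubeSide (F.P K).L M (RkOfRecord (F.P K).L ν.r (g j)) j ∣ (F.P K).sitesPerDir 0)
      -- the token's letters, `0 < B₃`, the (152)-letter `κ`, NOW POSITIVE (the door's guard)
      {B₃ C θ Q κ a₀ a₁ : ℝ} {Ψ : (ℕ → ℝ) → ℕ → ℝ} (_ : 0 < B₃) (_ : 0 ≤ C) (_ : 0 ≤ θ) (_ : 0 ≤ Q) (_ : 0 < κ)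
      -- V19's floor `2L² ≤ B₃` and the (162)–(166♭) smallness letters of the closers
      (_ : 2 * (F.L : ℝ) ^ 2 ≤ B₃) (_ : 4 * C ≤ B₃) (_ : 16 * θ ≤ 1) (_ : (16 * Q + 1024 * κ ^ 2) * a₀ ≤ 1) (_ : 32 * κ * a₀ ≤ 1)
      -- the chart side's TWO remaining PER-LEVEL SIZE LETTERS: (c′)'s near-row letter `β₁`, (d′)'s (158) letter `t₁`
      (β₁ t₁ : (ℕ → ℝ) → (ℕ → ℝ) → ℕ → ℝ)
      -- ★ HLETTERS of record (RANGED): the sign of `β₁` only (`β₂ = κ·L·ε_j ≥ 0` and `s′ = 0` are automatic)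
      (_ : ∀ (ε δ : ℕ → ℝ) (j : ℕ), 0 < δ j → δ j ≤ a₁ → B₃ * δ j ≤ ε j → ε j ≤ a₀ → 0 ≤ β₁ ε δ j)
      -- ★ HBUDGET of record (RANGED, CLOSED FORM): 77c's HBUDGET-NORM at `β₂ := κ·L·ε_j`, `s′ := 0`, `θ_H := 8C_H B_H e^{−δ_H ρ}`
      (_ : ∀ (K : ℕ) (ε δ : ℕ → ℝ) (j : ℕ), 0 < δ j → δ j ≤ a₁ → B₃ * δ j ≤ ε j → ε j ≤ a₀ →
        t₁ ε δ j + 1 / 4 * ((sideP (F.P K) Mc ρ : ℕ) : ℝ) *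
            max (4 * CH * BH * β₁ ε δ j) (8 * CH * BH * Real.exp (-(δH * (ρ : ℝ))) * (κ * (F.L : ℝ) * ε j)) <
          C * δ j + θ * ε j + Q * ε j ^ 2)
      -- ★ THE ONE CONDITIONAL PREMISE, GUARD EDITION (c-ii)‴ (candidate (β′), plan g94 WORD (B)): [6] Thm. 4 ∕ Prop. 6 with (152)–(153) and «ū = 1 on Λ′» at data carrying the grid letters at modulus `L·Mh`
      (hT : HThm4RecSym152PhiEG F N Mc ρ (F.L * Mh) κ a₀ Ψ)
      -- ★ HSEAM = (R4): the record's minimiser is PRINT-CRITICAL in cell form on the (2.3) cells of `domainsOfSeq s.Ω k` (its averages there ARE the data: derived from `AgreeOn (genSet …)`) — displayed, NOT discharged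
      (hseam : ∀ (ν : Stage7Numerics) (M : ℕ) (g : ℕ → ℝ) (K k : ℕ) (s : SeqOfRecord F ν M g K k), Sect2.SeqSeparated ν.M₁ s → 0 < ν.M₁ →
        Adm ν M g K k s → 1 ≤ k →
        ∀ (δ : ℕ → ℝ),
        ∀ W : MSField (F.P K) (SU N), Sect2.DataSmall7PTop (avOfRecord F N K) s.Ω (suppDomOfRecord F ν K s.Ω) k δ W →
        ∀ U : GaugeField (F.P K) 0 (SU N),
        AgreeOn (genSet s.Ω k) (avgFamily (avOfRecord F N K) U) W → IsCritOnFibre F N K (genSet s.Ω k) W U →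
        ∀ (hkk : k ≤ (F.P K).m + (F.P K).K),
        ∀ γ : ℝ → GaugeField (F.P K) 0 (SU N), γ 0 = U →
          DifferentiableAt ℝ (fun (t : ℝ) (b : PBond (F.P K) 0) => ((γ t b : SU N) : Matrix (Fin N) (Fin N) ℂ)) 0 →
            (∀ᶠ t in nhds (0 : ℝ), ∀ (j : ℕ) (c : PBond (F.P K) j), (domainsOfSeq s.Ω k hkk).LamBond j c →
              avgFamily (avOfRecord F N K) (γ t) j c = W j c) →
              ∀ a : ℝ, HasDerivAt (fun t => wilsonAction4 (γ t)) a 0 → a = 0)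
      -- ★ (c′) THE NEAR ROWS OF THE BLOCK AVERAGES `QA` on MODULE 77's near class — displayed, NOT discharged (MODULE 80's data rows + print's (156) linearisation; n07-w6 lineage) — 82b's text
      (hQnear :
        ∀ (ν : Stage7Numerics) (M : ℕ) (g : ℕ → ℝ) (K k : ℕ) (s : SeqOfRecord F ν M g K k), Sect2.SeqSeparated ν.M₁ s → 0 < ν.M₁ →
          Adm ν M g K k s → 1 ≤ k →
          ∀ (ε δ : ℕ → ℝ),
          (∀ n, n ≤ k → 0 < δ n ∧ δ n ≤ a₁) → (∀ n, n < k → δ n ≤ 2 * δ (n + 1)) → (∀ n, n < k → δ (n + 1) ≤ 2 * δ n) →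
          (∀ n, n ≤ k → B₃ * δ n ≤ ε n ∧ ε n ≤ a₀) → (∀ n, n < k → ε n ≤ 2 * ε (n + 1)) → (∀ n, n < k → ε (n + 1) ≤ 2 * ε n) →
          ∀ W : MSField (F.P K) (SU N), Sect2.DataSmall7PTop (avOfRecord F N K) s.Ω (suppDomOfRecord F ν K s.Ω) k δ W →
          ∀ U : GaugeField (F.P K) 0 (SU N),
          (∀ n, n ≤ k → PlaqSmallOn (Sect2.omegaPlaqsTop s.Ω (suppDomOfRecord F ν K s.Ω) n) (ε n * (F.P K).eta n ^ 2) U) →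
          (∀ n, n ≤ k → Sect2.CoDivSmallOn (Sect2.omegaBondsTop s.Ω (suppDomOfRecord F ν K s.Ω) n) (ε n * (F.P K).eta n ^ 3) U) →
          AgreeOn (genSet s.Ω k) (avgFamily (avOfRecord F N K) U) W → IsCritOnFibre F N K (genSet s.Ω k) W U →
          ∀ (n : ℕ) (hk : K - n ≤ (F.P K).m + (F.P K).K), 1 ≤ K - n → K - n ≤ k → ∀ (idx : Pt (F.P K).d),
          -- MEETING DATUMS ONLY: the print box has a point within `3` of a lift of a site of `Ω_{K−n}`
          (∃ x ∈ box (F.P K).L (cornerP (F.P K) Mc ρ idx) (sideP (F.P K) Mc ρ) (K - n), ∃ y : Pt (F.P K).d, cover (F.P K) y ∈ s.Ω (K - n) ∧ Within ((3 : ℕ) : ℤ) x y) →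
          -- PRINT-MARGIN-CLEAN DATUMS ONLY (print p. 300 + (144)'s margin cube «□̃» = the print box WIDENED BY `2ρ` BLOCKS): top level, or «□̃» misses `Ω_{j+1}`
          (K - n = k ∨ ∀ z ∈ box (F.P K).L (cornerP (F.P K) Mc ρ idx - ((2 * ρ : ℕ) : Pt (F.P K).d)) (sideP (F.P K) Mc ρ + 2 * (2 * ρ)) (K - n),
            cover (F.P K) z ∉ s.Ω (K - n + 1)) →
          -- THE FAMILY: print's (150) `Ω′_j = □_j (j < k), Ω′_k = □_k ∩ Ω_k`
          ∀ {HVd : Domains (F.P K)}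
            (_ : HVd = domainsMeet (cubeDomains (F.P K) (cornerP (F.P K) Mc ρ idx) (sideP (F.P K) Mc ρ) ρ (K - n) hk) (domainsOfSeq s.Ω (K - n) hk))
            (lo hi : ℕ → Pt (F.P K).d),
          lo 0 = (fun i => ((F.P K).L : ℤ) * (sqLo (F.P K).L (cornerP (F.P K) Mc ρ idx) ρ (K - n) 1 i - 1)) →
          hi 0 = (fun i => ((F.P K).L : ℤ) * (sqHi (F.P K).L (cornerP (F.P K) Mc ρ idx) (sideP (F.P K) Mc ρ) ρ (K - n) 1 i + 1) + (((F.P K).L : ℤ) - 1)) →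
          (∀ j', 1 ≤ j' → lo j' = sqLo (F.P K).L (cornerP (F.P K) Mc ρ idx) ρ (K - n) j' - 1) →
          (∀ j', 1 ≤ j' → hi j' = sqHi (F.P K).L (cornerP (F.P K) Mc ρ idx) (sideP (F.P K) Mc ρ) ρ (K - n) j' + 1) →
          ∀ (u : GaugeTransf (F.P K) 0 (SU N)) (A : PBond (F.P K) 0 → MatA N),
          (∀ b ∈ (Sect2.regionOfSet (F.P K) (cover (F.P K) '' box (F.P K).L (cornerP (F.P K) Mc ρ idx) (sideP (F.P K) Mc ρ) (K - n))).bonds,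
            gaugeU (fun x => ιSU N (u x)) (fun b' => ιSU N (U b')) b = expI ((F.P K).eta (K - n)) (A b)) →
          -- (T1) the gauge equation on the WHOLE TOWER `□₀` of the datum
          (∀ b ∈ (Sect2.regionOfSet (F.P K) (cover (F.P K) '' cube (F.P K).L (cornerP (F.P K) Mc ρ idx) (sideP (F.P K) Mc ρ) ρ (K - n) 0)).bonds,
            gaugeU (fun x => ιSU N (u x)) (fun b' => ιSU N (U b')) b = expI ((F.P K).eta (K - n)) (A b)) →
          -- (T2) (152)'s LEVEL-WEIGHTED letters on every `□_{j′}`, `j′ ≤ K − n`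
          (∀ j', j' ≤ K - n →
            ∀ b ∈ (Sect2.regionOfSet (F.P K) (cover (F.P K) '' cube (F.P K).L (cornerP (F.P K) Mc ρ idx) (sideP (F.P K) Mc ρ) ρ (K - n) j')).bonds,
              ‖A b‖ < κ * ε (K - n) * ((F.P K).L : ℝ) ^ (K - n - j')) →
          (∀ b ∈ (Sect2.regionOfSet (F.P K) (cover (F.P K) '' box (F.P K).L (cornerP (F.P K) Mc ρ idx) (sideP (F.P K) Mc ρ) (K - n))).bonds,
            ‖A b‖ < κ * ε (K - n)) →
          (∀ q ∈ (Sect2.regionOfSet (F.P K) (cover (F.P K) '' box (F.P K).L (cornerP (F.P K) Mc ρ idx) (sideP (F.P K) Mc ρ) (K - n))).dpairs,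
            ‖grad ((F.P K).eta (K - n)) q.2.1 (fun y => A ⟨y, q.2.2⟩) q.1‖ < κ * ε (K - n)) →
          (∀ b ∈ Sect2.bondsDeep (cover (F.P K) '' box (F.P K).L (cornerP (F.P K) Mc ρ idx) (sideP (F.P K) Mc ρ) (K - n)),
            ‖Sect2.codiffCurlA ((F.P K).eta (K - n)) A b.src b.dir‖ < κ * ε (K - n)) →
          (∀ b ∈ Sect2.bondsDeep (cover (F.P K) '' box (F.P K).L (cornerP (F.P K) Mc ρ idx) (sideP (F.P K) Mc ρ) (K - n)),
            ‖∑ ν' : Fin (F.P K).d, (((F.P K).eta (K - n) : ℝ) : ℂ)⁻¹ •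
                (grad ((F.P K).eta (K - n)) ν' (fun y => A ⟨y, b.dir⟩) (b.src.unshift ν') - grad ((F.P K).eta (K - n)) ν' (fun y => A ⟨y, b.dir⟩) b.src)‖ <
              κ * ε (K - n)) →
          (∀ D' : Domains (F.P K), LinearMap.ker (QpE D') ≤ LinearMap.ker (QpE HVd) → ∀ φ : MatA N →L[ℂ] ℂ,
            RE D' ((F.P K).eta (K - n))⁻¹ (dsE ((F.P K).eta (K - n))⁻¹ (WithLp.toLp 2 fun b => (φ (A b)).re : BondSpace (F.P K))) = 0 ∧
            RE D' ((F.P K).eta (K - n))⁻¹ (dsE ((F.P K).eta (K - n))⁻¹ (WithLp.toLp 2 fun b => (φ (A b)).im : BondSpace (F.P K))) = 0) →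
          -- ★ THE NORMALISATION of this `u` (print's «ū_j = 1 on Λ′_j»), as delivered by HS3NORM
          NrmSymPhiOfRecord F N Mc ρ (Ψ ε (K - n)) ν M g K k s U (K - n) idx u A →
          ∀ c : BondIdx HVd, ((c.1.1 : ℕ) = K - n ∨
              (blockOf c.1.2.src ∈ (cubeDomains (F.P K) (cornerP (F.P K) Mc ρ idx) (sideP (F.P K) Mc ρ) ρ (K - n) hk).Om ((c.1.1 : ℕ) + 1) ∧
                blockOf c.1.2.tgt ∈ (cubeDomains (F.P K) (cornerP (F.P K) Mc ρ idx) (sideP (F.P K) Mc ρ) ρ (K - n) hk).Om ((c.1.1 : ℕ) + 1))) →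
            ‖bondAvgIter (c.1.1 : ℕ) A c.1.2‖ ≤ β₁ ε δ (K - n))
      -- ★ (d′) THE (158) LETTERS of `A₁ = A − H_V(𝟙_reach·QA)` — displayed, NOT discharged (k0-s1 S4's line, at MODULE 76's pinned-local `H_V`)
      -- ★ (d′)-Lam: THE ∀-BODY OF MODULE 117′'s `hA1_lam_free` at the abstract letter `t₁` (NO normalisation binder) — displayed here, DISCHARGED at the head 100⁗
      (hA1L :
        ∀ (ν : Stage7Numerics) (M : ℕ) (g : ℕ → ℝ) (K k : ℕ) (s : SeqOfRecord F ν M g K k), Sect2.SeqSeparated ν.M₁ s → 0 < ν.M₁ →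
          Adm ν M g K k s → 1 ≤ k →
          ∀ (ε δ : ℕ → ℝ),
          (∀ n, n ≤ k → 0 < δ n ∧ δ n ≤ a₁) → (∀ n, n < k → δ n ≤ 2 * δ (n + 1)) → (∀ n, n < k → δ (n + 1) ≤ 2 * δ n) →
          (∀ n, n ≤ k → B₃ * δ n ≤ ε n ∧ ε n ≤ a₀) → (∀ n, n < k → ε n ≤ 2 * ε (n + 1)) → (∀ n, n < k → ε (n + 1) ≤ 2 * ε n) →
          ∀ W : MSField (F.P K) (SU N), Sect2.DataSmall7PTop (avOfRecord F N K) s.Ω (suppDomOfRecord F ν K s.Ω) k δ W →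
          ∀ U : GaugeField (F.P K) 0 (SU N),
          (∀ n, n ≤ k → PlaqSmallOn (Sect2.omegaPlaqsTop s.Ω (suppDomOfRecord F ν K s.Ω) n) (ε n * (F.P K).eta n ^ 2) U) →
          (∀ n, n ≤ k → Sect2.CoDivSmallOn (Sect2.omegaBondsTop s.Ω (suppDomOfRecord F ν K s.Ω) n) (ε n * (F.P K).eta n ^ 3) U) →
          ∀ (hkk : k ≤ (F.P K).m + (F.P K).K),
          (∀ (j : ℕ) (c : PBond (F.P K) j), (domainsOfSeq s.Ω k hkk).LamBond j c → avgFamily (avOfRecord F N K) U j c = W j c) →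
          (∀ γ : ℝ → GaugeField (F.P K) 0 (SU N), γ 0 = U →
            DifferentiableAt ℝ (fun (t : ℝ) (b : PBond (F.P K) 0) => ((γ t b : SU N) : Matrix (Fin N) (Fin N) ℂ)) 0 →
              (∀ᶠ t in nhds (0 : ℝ), ∀ (j : ℕ) (c : PBond (F.P K) j), (domainsOfSeq s.Ω k hkk).LamBond j c →
                avgFamily (avOfRecord F N K) (γ t) j c = W j c) →
                ∀ a : ℝ, HasDerivAt (fun t => wilsonAction4 (γ t)) a 0 → a = 0) →
          ∀ (n : ℕ) (hk : K - n ≤ (F.P K).m + (F.P K).K), 1 ≤ K - n → K - n ≤ k → ∀ (idx : Pt (F.P K).d),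
          -- MEETING DATUMS ONLY: the print box has a point within `3` of a lift of a site of `Ω_{K−n}`
          (∃ x ∈ box (F.P K).L (cornerP (F.P K) Mc ρ idx) (sideP (F.P K) Mc ρ) (K - n), ∃ y : Pt (F.P K).d, cover (F.P K) y ∈ s.Ω (K - n) ∧ Within ((3 : ℕ) : ℤ) x y) →
          -- PRINT-MARGIN-CLEAN DATUMS ONLY (print p. 300 + (144)'s margin cube «□̃» = the print box WIDENED BY `2ρ` BLOCKS): top level, or «□̃» misses `Ω_{j+1}`
          (K - n = k ∨ ∀ z ∈ box (F.P K).L (cornerP (F.P K) Mc ρ idx - ((2 * ρ : ℕ) : Pt (F.P K).d)) (sideP (F.P K) Mc ρ + 2 * (2 * ρ)) (K - n),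
            cover (F.P K) z ∉ s.Ω (K - n + 1)) →
          -- THE FAMILY: print's (150) `Ω′_j = □_j (j < k), Ω′_k = □_k ∩ Ω_k`
          ∀ {HVd : Domains (F.P K)}
            (_ : HVd = domainsMeet (cubeDomains (F.P K) (cornerP (F.P K) Mc ρ idx) (sideP (F.P K) Mc ρ) ρ (K - n) hk) (domainsOfSeq s.Ω (K - n) hk))
            (lo hi : ℕ → Pt (F.P K).d),
          lo 0 = (fun i => ((F.P K).L : ℤ) * (sqLo (F.P K).L (cornerP (F.P K) Mc ρ idx) ρ (K - n) 1 i - 1)) →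
          hi 0 = (fun i => ((F.P K).L : ℤ) * (sqHi (F.P K).L (cornerP (F.P K) Mc ρ idx) (sideP (F.P K) Mc ρ) ρ (K - n) 1 i + 1) + (((F.P K).L : ℤ) - 1)) →
          (∀ j', 1 ≤ j' → lo j' = sqLo (F.P K).L (cornerP (F.P K) Mc ρ idx) ρ (K - n) j' - 1) →
          (∀ j', 1 ≤ j' → hi j' = sqHi (F.P K).L (cornerP (F.P K) Mc ρ idx) (sideP (F.P K) Mc ρ) ρ (K - n) j' + 1) →
          ∀ (HV : (BondIdx HVd → MatA N) →ₗ[ℂ] (PBond (F.P K) 0 → MatA N)),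
            (∀ (Bf : BondIdx HVd → MatA N) (b : PBond (F.P K) 0), HV Bf b = ∑ c, ((flatH (F.P K) (K - n) HVd (Pi.single c 1) b : ℝ) : ℂ) • Bf c) →
          ∀ (u : GaugeTransf (F.P K) 0 (SU N)) (A : PBond (F.P K) 0 → MatA N),
          (∀ b ∈ (Sect2.regionOfSet (F.P K) (cover (F.P K) '' box (F.P K).L (cornerP (F.P K) Mc ρ idx) (sideP (F.P K) Mc ρ) (K - n))).bonds,
            gaugeU (fun x => ιSU N (u x)) (fun b' => ιSU N (U b')) b = expI ((F.P K).eta (K - n)) (A b)) →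
          -- (T1) the gauge equation on the WHOLE TOWER `□₀` of the datum
          (∀ b ∈ (Sect2.regionOfSet (F.P K) (cover (F.P K) '' cube (F.P K).L (cornerP (F.P K) Mc ρ idx) (sideP (F.P K) Mc ρ) ρ (K - n) 0)).bonds,
            gaugeU (fun x => ιSU N (u x)) (fun b' => ιSU N (U b')) b = expI ((F.P K).eta (K - n)) (A b)) →
          -- (T2) (152)'s LEVEL-WEIGHTED letters on every `□_{j′}`, `j′ ≤ K − n`
          (∀ j', j' ≤ K - n →
            ∀ b ∈ (Sect2.regionOfSet (F.P K) (cover (F.P K) '' cube (F.P K).L (cornerP (F.P K) Mc ρ idx) (sideP (F.P K) Mc ρ) ρ (K - n) j')).bonds,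
              ‖A b‖ < κ * ε (K - n) * ((F.P K).L : ℝ) ^ (K - n - j')) →
          (∀ j', j' ≤ K - n →
            ∀ q ∈ (Sect2.regionOfSet (F.P K) (cover (F.P K) '' cube (F.P K).L (cornerP (F.P K) Mc ρ idx) (sideP (F.P K) Mc ρ) ρ (K - n) j')).dpairs,
              ‖grad ((F.P K).eta (K - n)) q.2.1 (fun y => A ⟨y, q.2.2⟩) q.1‖ < κ * ε (K - n) * ((F.P K).L : ℝ) ^ (2 * (K - n - j'))) →
          (∀ b ∈ (Sect2.regionOfSet (F.P K) (cover (F.P K) '' box (F.P K).L (cornerP (F.P K) Mc ρ idx) (sideP (F.P K) Mc ρ) (K - n))).bonds,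
            ‖A b‖ < κ * ε (K - n)) →
          (∀ q ∈ (Sect2.regionOfSet (F.P K) (cover (F.P K) '' box (F.P K).L (cornerP (F.P K) Mc ρ idx) (sideP (F.P K) Mc ρ) (K - n))).dpairs,
            ‖grad ((F.P K).eta (K - n)) q.2.1 (fun y => A ⟨y, q.2.2⟩) q.1‖ < κ * ε (K - n)) →
          (∀ b ∈ Sect2.bondsDeep (cover (F.P K) '' box (F.P K).L (cornerP (F.P K) Mc ρ idx) (sideP (F.P K) Mc ρ) (K - n)),
            ‖Sect2.codiffCurlA ((F.P K).eta (K - n)) A b.src b.dir‖ < κ * ε (K - n)) →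
          (∀ b ∈ Sect2.bondsDeep (cover (F.P K) '' box (F.P K).L (cornerP (F.P K) Mc ρ idx) (sideP (F.P K) Mc ρ) (K - n)),
            ‖∑ ν' : Fin (F.P K).d, (((F.P K).eta (K - n) : ℝ) : ℂ)⁻¹ •
                (grad ((F.P K).eta (K - n)) ν' (fun y => A ⟨y, b.dir⟩) (b.src.unshift ν') - grad ((F.P K).eta (K - n)) ν' (fun y => A ⟨y, b.dir⟩) b.src)‖ <
              κ * ε (K - n)) →
          (∀ D' : Domains (F.P K), LinearMap.ker (QpE D') ≤ LinearMap.ker (QpE HVd) → ∀ φ : MatA N →L[ℂ] ℂ,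
            RE D' ((F.P K).eta (K - n))⁻¹ (dsE ((F.P K).eta (K - n))⁻¹ (WithLp.toLp 2 fun b => (φ (A b)).re : BondSpace (F.P K))) = 0 ∧
            RE D' ((F.P K).eta (K - n))⁻¹ (dsE ((F.P K).eta (K - n))⁻¹ (WithLp.toLp 2 fun b => (φ (A b)).im : BondSpace (F.P K))) = 0) →
          Letters10On (cover (F.P K) '' box (F.P K).L (cornerP (F.P K) Mc ρ idx) (sideP (F.P K) Mc ρ) (K - n)) ((F.P K).eta (K - n)) (t₁ ε δ (K - n))
            (fun b => A b - HV (fun c : BondIdx HVd =>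
              if (∀ x : Site (F.P K) 0, (iterBlockOf (c.1.1 : ℕ) x = c.1.2.src ∨ iterBlockOf (c.1.1 : ℕ) x = c.1.2.tgt) →
                  x ∈ cover (F.P K) '' cube (F.P K).L (cornerP (F.P K) Mc ρ idx) (sideP (F.P K) Mc ρ) ρ (K - n) 0)
              then bondAvgIter (c.1.1 : ℕ) A c.1.2 else 0) b)),
      Prop8RegSepTopStepG F N (fun ν K Ω => suppDomOfRecord F ν K Ω) Adm B₃ a₀ a₁ := by
  obtain ⟨Mh₀, R₀, CH, δH, BH, hCH, hδH, hBH, hmain⟩ := datumGaugeSplitTopStepCoreG_of_normalisedGauge_of_chartMeetTowerW152E F N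
  refine ⟨Mh₀, R₀, CH, δH, BH, hCH, hδH, hBH, ?_⟩
  intro ρ Mc Mh R a' hMc hMcρ hMha hMh hR hdvd hRρ hLρ c c₀ hc hc₀ hmc₀ hac₀ Adm hAdm₁ hAdm₂ B₃ C θ Q κ a₀ a₁ Ψ hB₃ hC0 hθ0 hQ0 hκ
    hB₃L hC hθ ha hκa β₁ t₁ hβ₁ hbudget hT hseam hQnear hA1L
  -- the letters of record: `β₂ := κ·L·ε_j` (MODULE 78 ∕ 82b), `s′ := 0` (82a's `B′ := 0`), `θ_H := 8 C_H B_H e^{−δ_H ρ}` (77c's floor)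
  have hletters : ∀ (ε δ : ℕ → ℝ) (j : ℕ), 0 < δ j → δ j ≤ a₁ → B₃ * δ j ≤ ε j → ε j ≤ a₀ →
      0 ≤ β₁ ε δ j ∧ 0 ≤ (fun (ε : ℕ → ℝ) (_ : ℕ → ℝ) (j : ℕ) => κ * (F.L : ℝ) * ε j) ε δ j ∧
        0 ≤ (fun (_ : ℕ → ℝ) (_ : ℕ → ℝ) (_ : ℕ) => (0 : ℝ)) ε δ j := by
    intro ε δ j hδ hδa hBδ hεa
    have hεj : 0 ≤ ε j := by nlinarith
    exact ⟨hβ₁ ε δ j hδ hδa hBδ hεa, mul_nonneg (mul_nonneg hκ.le (Nat.cast_nonneg _)) hεj, le_rfl⟩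
  have hbudget' : ∀ (K : ℕ) (ε δ : ℕ → ℝ) (j : ℕ), 0 < δ j → δ j ≤ a₁ → B₃ * δ j ≤ ε j → ε j ≤ a₀ → ∃ t₂ t₃ : ℝ,
      1 / 4 * ((sideP (F.P K) Mc ρ : ℕ) : ℝ) *
          max (4 * CH * BH * β₁ ε δ j)
            (8 * CH * BH * Real.exp (-(δH * (ρ : ℝ))) * (fun (ε : ℕ → ℝ) (_ : ℕ → ℝ) (j : ℕ) => κ * (F.L : ℝ) * ε j) ε δ j) < t₂ ∧
        2 * CH * BH * (fun (_ : ℕ → ℝ) (_ : ℕ → ℝ) (_ : ℕ) => (0 : ℝ)) ε δ j < t₃ ∧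
        t₁ ε δ j + t₂ + t₃ < C * δ j + θ * ε j + Q * ε j ^ 2 := by
    intro K ε δ j hδ hδa hBδ hεa
    obtain ⟨t₂, t₃, ht₂, ht₃, hsum⟩ := exists_thresholds_of_budget_lt (hbudget K ε δ j hδ hδa hBδ hεa)
    exact ⟨t₂, t₃, ht₂, by simpa only [mul_zero] using ht₃, hsum⟩
  exact prop8RegSepTopStepG_of_datumGaugeSplitCoreG hMc hLρ
    (hmain hMc hMcρ hMha hMh hR hdvd hRρ hLρ hc hc₀ hmc₀ hac₀ Adm hAdm₁ hAdm₂ hB₃ hC0 hθ0 hQ0 hκ.le le_rfl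
      β₁ (fun (ε : ℕ → ℝ) (_ : ℕ → ℝ) (j : ℕ) => κ * (F.L : ℝ) * ε j) (fun (_ : ℕ → ℝ) (_ : ℕ → ℝ) (_ : ℕ) => (0 : ℝ)) t₁ hletters hbudget' hseam
      (fun ν M g K k s ε U j idx u A => NrmSymPhiOfRecord F N Mc ρ (Ψ ε j) ν M g K k s U j idx u A) (hS3NORMSym152PhiE_of_hThm4RecSym152PhiEG F N hc hc₀ Adm hAdm₁ hAdm₂ hB₃ hκ hT)
      (chartMeetNorm77_of_letters_sym152E F N hLρ Adm hB₃ hκ.le β₁ (fun (ε : ℕ → ℝ) (_ : ℕ → ℝ) (j : ℕ) => κ * (F.L : ℝ) * ε j)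
        (fun (_ : ℕ → ℝ) (_ : ℕ → ℝ) (_ : ℕ) => (0 : ℝ)) t₁ rfl (fun _ _ _ => le_rfl) hQnear hA1L))
    hB₃L hC hθ hQ0 hκ.le ha hκa

end Summit.QuantumFields.YangMills.BalabanUVNodes.N07Prop8StepTokenOfRecordOfLettersSym152EG

end
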